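import Literature.Barriers.ValiantsHypothesis.GCTMatrixPoweringProp19
import HarnessLib

/-!
# Gesmundo–Ikenmeyer–Panova 2017, Prop. 17 ("if" directions) PROVED, and the assembly:
# `GCTMatrixPowering` (= GIP Thm. 10) from the single named fact `GIP2017_prop18_corrected`

Sibling file (D-0014) of `GCTMatrixPoweringProp19.lean` (corrected Prop. 19, proved; block
partitions `blocks`), `GCTMatrixPoweringColumnSign.lean` (Thm. 16: `smPos_column_of_sign_eq_one`,
`amPos_column_of_sign_eq_neg_one`, `sign_transposePerm_of_self`), `GCTMatrixPoweringSemigroup.lean`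
(`GIP2017_prop15_holds`) and `GCTMatrixPoweringErratum.lean` (`GIP2017_prop18_corrected`,
`GIP2017_prop20_corrected`, `GIP2017_prop20_corrected_of_parts`, `gctMatrixPowering_of_prop20_corrected`).
Conventions as there (`SmPos m λ` = "`sm(λ, m) > 0`", `AmPos`, `gipXs = X_s`, `gipXa = X_a`,
`gipEll L = max{⌈√L⌉ + 2, 12}`).

**What this file proves** (no `sorry`, no new definition, no named fact):

1. **Prop. 17, the "if" directions** (`GIP2017_prop17_if`): for `a ≥ 1` and
   `ℓ = max{⌊√a⌋ + 2, 12}`, `sm(1^a, ℓ) > 0` if `a ∉ X_s = {2,3,4,7,8,12}` and `am(1^a, ℓ) > 0` if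
   `a ∉ X_a = {1,2,5,6,10,14}`. Printed proof (GIP p. 10): "To prove positivity, we apply Theorem 16.
   For each `a` we will find self-conjugate partitions `μ, ν ⊢ a`, such that `ℓ(μ), ℓ(ν) ≤ ℓ` and
   `sgn(μ) = 1`, `sgn(ν) = -1`", with a table for `a ≤ 14` and the families `α, β, γ, δ` (square
   `b^b` or `(d+1)^d` plus thin arms) for `a ≥ 100`, the range `15 ≤ a ≤ 99` "treated as above"
   with thicker arms. Here: the number of diagonal boxes of the row-reading tableau is the Durfee
   size read off the rows (`card_filter_rowOf_eq_colOf`), so `sgn(μ) = (-1)^{(a - d(μ))/2}`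
   (`sign_transposePerm_of_rows`, from `sign_transposePerm_of_self`); the self-conjugate templates
   `T(d; j, y) = ((d+W)^j, d+y, d^{d-1-j}, (j+1)^y, j^{W-y}) ⊢ d² + 2(jW + y)` and
   `T₀(d; y) = (d+y, d^{d-1}, 1^y) ⊢ d² + 2y` (block partitions; self-conjugacy and Durfee size by
   arithmetic) give one witness of Durfee size `d` and length `≤ L` whenever `a = d² + 2h`,
   `h ≤ d(L - d)` (`smPos_amPos_column_of_le`); for `a ≥ 16` two witnesses of Durfee sizes `d₀`
   and `d₀ - 2` (`d₀ ∈ {⌊√a⌋, ⌊√a⌋ - 1}` by parity) exist within `max{⌊√a⌋ + 2, 12}` rows and have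
   opposite signs, giving both `sm > 0` and `am > 0` (`smPos_and_amPos_column_of_sixteen_le`);
   `a ≤ 15` is a table of single witnesses whose sign parity is decided numerically (and reproduces
   `X_s`, `X_a` exactly). The "only if" directions of the vendored iff `GIP2017_prop17` (a direct
   calculation in print) are not needed downstream and are not proved here.
2. **The assembly** (`GIP2017_prop20_corrected_of_prop18`): GIP's case analysis proving Prop. 20
   (corrected), verbatim from `GIP2017_prop20_corrected_of_parts` but with its other ingredients
   now proved — Prop. 15 (`GIP2017_prop15_holds`), Prop. 17's positivity (`GIP2017_prop17_if`),
   and the corrected Prop. 19 (`GIP2017_prop19_corrected_holds`; the printed/vendored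
   `GIP2017_prop19` is false, see the Prop. 19 file; Prop. 20 applies it to `(2,2,1^{k-2})`,
   `k > 14`, at `ℓ ≥ ⌈√k⌉ + 2 ≥` the corrected bound, `max_seven_sqrt_add_two_le_gipEll`). Hence
   `GIP2017_thm10_of_prop18` and **`gctMatrixPowering_of_prop18 : GIP2017_prop18_corrected →
   GCTMatrixPowering`**: the barrier fact rests on the one published computer calculation
   (Prop. 18, corrected by the shape `(2,1³)`), all other steps of GIP's proof of Thm. 10 being
   proved in the tree (Lemma 12, Prop. 13, Prop. 15, Thm. 16, Prop. 17 ("if"), Prop. 19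
   (corrected), Prop. 20 (corrected), Prop. 14).

## References

* [GesmundoIkenmeyerPanova2017] F. Gesmundo, C. Ikenmeyer, G. Panova, *Geometric complexity theory
  and matrix powering*, Diff. Geom. Appl. 55 (2017) 106–127 = arXiv:1611.00827: §3 (Thm. 16,
  Prop. 17 and its proof, Props. 18–20 and the proof of Prop. 20), Prop. 14, Thm. 10.
* [FultonYoungTableaux1997] W. Fulton, *Young Tableaux* (1997), §0 (conjugate partition), §7.1
  (row-reading numbering).
-/

noncomputable section

open scoped BigOperators

namespace Literature.Barriers.ValiantsHypothesis

open Literature.NumberTheory.DiophantineGeometry Literature.Computability.Complexity Finset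

/-! ### 1. GIP Prop. 17, the "if" directions: explicit self-conjugate partitions with prescribed sign -/

section Prop17If

variable {D : ℕ}

/-- **The number of diagonal boxes**: the entries of the row-reading tableau of `μ` lying on the
diagonal are counted by the rows `r` with `μ_{r+1} > r` (the Durfee size of `μ`).
[cite: GesmundoIkenmeyerPanova2017, §3 (boxes on the main diagonal, before Thm. 16)] -/
theorem card_filter_rowOf_eq_colOf (μ : Nat.Partition D) {K : ℕ} (hK : μ.parts.card ≤ K) :
    (Finset.univ.filter fun i : Fin D => μ.rowOf i = μ.colOf i).card =
      ((Finset.range K).filter fun r => r < μ.sortedParts.getD r 0).card := by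
  refine Finset.card_bij (fun i _ => μ.rowOf i) ?_ ?_ ?_
  · intro i hi
    rw [Finset.mem_filter] at hi ⊢
    have hmem := μ.rowOf_colOf_mem_youngDiagram i
    rw [Nat.Partition.mem_youngDiagram_iff] at hmem
    obtain ⟨hlt, hcol⟩ := hmem
    refine ⟨Finset.mem_range.mpr ?_, ?_⟩
    · calc μ.rowOf i < μ.sortedParts.length := hlt
        _ = μ.parts.card := Nat.Partition.length_sortedParts μ
        _ ≤ K := hK
    · rw [List.getD_eq_getElem _ _ hlt]
      have h := hcol
      simp only at h
      rw [← hi.2] at h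
      exact h
  · intro i hi j hj h
    rw [Finset.mem_filter] at hi hj
    apply μ.rowOf_colOf_injective
    simp only [Prod.mk.injEq]
    exact ⟨h, by rw [← hi.2, ← hj.2, h]⟩
  · intro r hr
    rw [Finset.mem_filter, Finset.mem_range] at hr
    obtain ⟨-, hrr⟩ := hr
    have hlen : r < μ.sortedParts.length := by
      by_contra hge
      rw [List.getD_eq_default _ _ (not_lt.mp hge)] at hrr
      exact absurd hrr (Nat.not_lt_zero r)
    have hmem : (r, r) ∈ μ.youngDiagram := by
      rw [Nat.Partition.mem_youngDiagram_iff]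
      exact ⟨hlen, by rwa [List.getD_eq_getElem _ _ hlen] at hrr⟩
    obtain ⟨i, hi, -⟩ := (μ.mem_youngDiagram_iff_existsUnique_rowOf_colOf _).mp hmem
    simp only [Prod.mk.injEq] at hi
    exact ⟨i, Finset.mem_filter.mpr ⟨Finset.mem_univ _, hi.1.trans hi.2.symm⟩, hi.1⟩

/-- **`sgn(μ) = (-1)^{(D - d)/2}` with `d` the Durfee size read off the rows** (`μ_{r+1} > r` iff
`r < d`). [cite: GesmundoIkenmeyerPanova2017, §3 (definition of sgn(λ)) and Prop. 36] -/
theorem sign_transposePerm_of_rows (μ : Nat.Partition D) (hself : μ.transpose = μ) {K d : ℕ}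
    (hK : μ.parts.card ≤ K) (hdK : d ≤ K) (hd : ∀ r, r < μ.sortedParts.getD r 0 ↔ r < d) :
    Equiv.Perm.sign μ.transposePerm = (-1) ^ ((D - d) / 2) := by
  rw [sign_transposePerm_of_self μ hself, card_filter_rowOf_eq_colOf μ hK]
  have hf : (Finset.range K).filter (fun r => r < μ.sortedParts.getD r 0) = Finset.range d := by
    ext r
    simp only [Finset.mem_filter, Finset.mem_range, hd]
    omega
  rw [hf, Finset.card_range]

/-- From a self-conjugate witness of Durfee size `d`: `sm(1^D, ℓ) > 0` if `(D - d)/2` is even,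
`am(1^D, ℓ) > 0` if it is odd (Thm. 16). [cite: GesmundoIkenmeyerPanova2017, Thm. 16 and Prop. 17 (proof)] -/
theorem smPos_amPos_column_of_witness {d ℓ : ℕ} (μ : Nat.Partition D) (hself : μ.transpose = μ)
    (hsign : Equiv.Perm.sign μ.transposePerm = (-1) ^ ((D - d) / 2)) (hcard : μ.parts.card ≤ ℓ) :
    (Even ((D - d) / 2) → SmPos ℓ (Nat.Partition.column D)) ∧
      (Odd ((D - d) / 2) → AmPos ℓ (Nat.Partition.column D)) := by
  constructor
  · intro h
    have h1 : Equiv.Perm.sign μ.transposePerm = 1 := by rw [hsign]; exact h.neg_one_pow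
    exact (smPos_column_of_sign_eq_one μ hself h1).mono hcard
  · intro h
    have h1 : Equiv.Perm.sign μ.transposePerm = -1 := by rw [hsign]; exact h.neg_one_pow
    exact (amPos_column_of_sign_eq_neg_one μ hself h1).mono hcard

/-- **Template `T(d; j, y)`**: the self-conjugate partition with Durfee square `d = j + 1 + e`, arm
`α = (W^j, y)` (`W = y + z`) to the right of the square and `αᵗ` below it, i.e. the block
partition `((d+W)^j, d+y, d^e, (j+1)^y, j^z) ⊢ d² + 2(jW + y)`, of length `d + W` and sign
`(-1)^{(D-d)/2}` — the shape of GIP's `α, β, γ, δ` (Prop. 17, proof). [cite: GesmundoIkenmeyerPanova2017, Prop. 17 (proof: the partitions α, β, γ, δ)] -/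
theorem smPos_amPos_column_T (j e y z : ℕ) (hj : 1 ≤ j)
    (hD : (j + 1 + e) * (j + 1 + e) + 2 * (j * (y + z) + y) = D) {ℓ : ℕ} (hℓ : j + 1 + e + y + z ≤ ℓ) :
    (Even ((D - (j + 1 + e)) / 2) → SmPos ℓ (Nat.Partition.column D)) ∧
      (Odd ((D - (j + 1 + e)) / 2) → AmPos ℓ (Nat.Partition.column D)) := by
  have hsum : j * (j + 1 + e + y + z) + 1 * (j + 1 + e + y) + e * (j + 1 + e) + y * (j + 1) + z * j = D := by
    rw [← hD]; ring
  let μ : Nat.Partition D := blocks j (j + 1 + e + y + z) 1 (j + 1 + e + y) e (j + 1 + e) y (j + 1) z j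
    (by omega) hsum
  have hself : μ.transpose = μ := blocks_transpose_eq_self _ _ fun r => by split_ifs <;> omega
  refine smPos_amPos_column_of_witness μ hself
    (sign_transposePerm_of_rows μ hself (K := j + 1 + e + y + z) (d := j + 1 + e)
      ((card_blocks_parts _ _).trans_le (by omega)) (by omega) fun r => ?_)
    ((card_blocks_parts _ _).trans_le (by omega))
  rw [getD_sortedParts_blocks]
  split_ifs <;> omega

/-- **Template `T₀(d; y)`** (no full arm rows): the hook-on-a-square `(d+y, d^{d-1}, 1^y) ⊢ d² + 2y`
(`d = e + 1`), self-conjugate of length `d + y` and sign `(-1)^{(D-d)/2}`.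
[cite: GesmundoIkenmeyerPanova2017, Prop. 17 (proof: the partitions α, γ)] -/
theorem smPos_amPos_column_T₀ (e y : ℕ) (hD : (e + 1) * (e + 1) + 2 * y = D) {ℓ : ℕ}
    (hℓ : e + 1 + y ≤ ℓ) :
    (Even ((D - (e + 1)) / 2) → SmPos ℓ (Nat.Partition.column D)) ∧
      (Odd ((D - (e + 1)) / 2) → AmPos ℓ (Nat.Partition.column D)) := by
  have hsum : 1 * (e + 1 + y) + e * (e + 1) + y * 1 + 0 * 1 + 0 * 1 = D := by rw [← hD]; ring
  let μ : Nat.Partition D := blocks 1 (e + 1 + y) e (e + 1) y 1 0 1 0 1 (by omega) hsum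
  have hself : μ.transpose = μ := blocks_transpose_eq_self _ _ fun r => by split_ifs <;> omega
  refine smPos_amPos_column_of_witness μ hself
    (sign_transposePerm_of_rows μ hself (K := e + 1 + y) (d := e + 1)
      ((card_blocks_parts _ _).trans_le (by omega)) (by omega) fun r => ?_)
    ((card_blocks_parts _ _).trans_le (by omega))
  rw [getD_sortedParts_blocks]
  split_ifs <;> omega

/-- **One self-conjugate witness of Durfee size `d` and length `≤ L`** exists as soon as
`D = d² + 2h` with `h ≤ d(L - d)` (`h` boxes in `d` arm rows of length `≤ L - d`): then
`sm(1^D, L) > 0` if `(D-d)/2` is even and `am(1^D, L) > 0` if it is odd.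
[cite: GesmundoIkenmeyerPanova2017, Prop. 17 (proof)] -/
theorem smPos_amPos_column_of_le {d h L : ℕ} (hd : 1 ≤ d) (hdL : d ≤ L) (hD : D = d * d + 2 * h)
    (hcap : h ≤ d * (L - d)) :
    (Even ((D - d) / 2) → SmPos L (Nat.Partition.column D)) ∧
      (Odd ((D - d) / 2) → AmPos L (Nat.Partition.column D)) := by
  obtain ⟨e, rfl⟩ : ∃ e, d = e + 1 := ⟨d - 1, by omega⟩
  by_cases hW : h ≤ L - (e + 1)
  · -- no full arm rows: `T₀`
    exact smPos_amPos_column_T₀ e h hD.symm (by omega)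
  · -- `h = j W + y` with `W = L - d`, `1 ≤ y ≤ W`, `1 ≤ j < d`: `T`
    set W := L - (e + 1) with hWdef
    have hWpos : 0 < W := by
      rcases Nat.eq_zero_or_pos W with h0 | h0
      · rw [h0, Nat.mul_zero] at hcap; omega
      · exact h0
    have hdm := Nat.div_add_mod' (h - 1) W
    have hml := Nat.mod_lt (h - 1) hWpos
    set j := (h - 1) / W with hjdef
    set y := (h - 1) % W + 1 with hydef
    have hh : h = j * W + y := by omega
    have hj1 : 1 ≤ j := by
      rw [hjdef, Nat.one_le_div_iff hWpos]; omega
    have hjd : j < e + 1 := by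
      refine Nat.lt_of_mul_lt_mul_right (a := W) ?_
      calc j * W < j * W + y := by omega
        _ = h := hh.symm
        _ ≤ (e + 1) * W := hcap
    obtain ⟨e', he'⟩ : ∃ e', e = j + e' := ⟨e - j, by omega⟩
    obtain ⟨z, hz⟩ : ∃ z, W = y + z := ⟨W - y, by omega⟩
    have hD' : (j + 1 + e') * (j + 1 + e') + 2 * (j * (y + z) + y) = D := by
      rw [hD, ← hz, hh, he']; ring
    have key := smPos_amPos_column_T j e' y z hj1 hD' (ℓ := L) (by omega)
    rwa [show j + 1 + e' = e + 1 from by omega] at key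

/-- Capacity of the second witness (`d = b - 2`) when `D ≡ b (mod 2)`, `b = ⌊√D⌋ ≥ 3`,
`L = max{b + 2, 12}`: `3b - 2 ≤ (b - 2)(L - b + 2)`. [cite: GesmundoIkenmeyerPanova2017, Prop. 17 (proof: "ℓ(β) ≤ b+2")] -/
theorem prop17_cap₂ {b : ℕ} (hb : 3 ≤ b) : 3 * b - 2 ≤ (b - 2) * (max (b + 2) 12 - b + 2) := by
  rcases Nat.lt_or_ge b 10 with h | h
  · interval_cases b <;> decide
  · rw [max_eq_left (by omega), show b + 2 - b + 2 = 4 from by omega]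
    omega

/-- Capacity of the first witness (`d = b - 1`) when `D ≢ b (mod 2)`, `b ≥ 2`:
`2b - 1 ≤ (b - 1)(L - b + 1)`. [cite: GesmundoIkenmeyerPanova2017, Prop. 17 (proof: "ℓ(γ) ≤ d+3 = b+2")] -/
theorem prop17_cap₁' {b : ℕ} (hb : 2 ≤ b) : 2 * b - 1 ≤ (b - 1) * (max (b + 2) 12 - b + 1) := by
  rcases Nat.lt_or_ge b 10 with h | h
  · interval_cases b <;> decide
  · rw [max_eq_left (by omega), show b + 2 - b + 1 = 3 from by omega]
    omega

/-- Capacity of the second witness (`d = b - 3`) when `D ≢ b (mod 2)`, `b ≥ 4`: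
`4b - 5 ≤ (b - 3)(L - b + 3)`. [cite: GesmundoIkenmeyerPanova2017, Prop. 17 (proof: "ℓ(δ) ≤ d+4 = b+3", corrected to b+2 by the thicker arm)] -/
theorem prop17_cap₂' {b : ℕ} (hb : 4 ≤ b) : 4 * b - 5 ≤ (b - 3) * (max (b + 2) 12 - b + 3) := by
  rcases Nat.lt_or_ge b 10 with h | h
  · interval_cases b <;> decide
  · rw [max_eq_left (by omega), show b + 2 - b + 3 = 5 from by omega]
    omega

/-- **GIP Prop. 17, "if" directions, for `a ≥ 16`**: both `sm(1^a, ℓ) > 0` and `am(1^a, ℓ) > 0`,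
`ℓ = max{⌊√a⌋ + 2, 12}` — two self-conjugate witnesses of Durfee sizes `d` and `d - 2`
(`d = ⌊√a⌋` or `⌊√a⌋ - 1` by parity), whose signs `(-1)^{(a-d)/2}`, `(-1)^{(a-d)/2 + 1}` differ.
[cite: GesmundoIkenmeyerPanova2017, Prop. 17 (proof, cases a ≥ 100 and 15 ≤ a ≤ 99)] -/
theorem smPos_and_amPos_column_of_sixteen_le {a : ℕ} (ha : 16 ≤ a) :
    SmPos (max (Nat.sqrt a + 2) 12) (Nat.Partition.column a) ∧
      AmPos (max (Nat.sqrt a + 2) 12) (Nat.Partition.column a) := by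
  set b := Nat.sqrt a with hb
  set L := max (b + 2) 12 with hL
  have hb1 : b * b ≤ a := Nat.sqrt_le a
  have hb2 : a < (b + 1) * (b + 1) := Nat.lt_succ_sqrt a
  have hb4 : 4 ≤ b := by rw [hb, Nat.le_sqrt]; exact ha
  have hLb : b + 2 ≤ L := le_max_left _ _
  have hL12 : 12 ≤ L := le_max_right _ _
  clear_value b
  have hsq : (b + 1) * (b + 1) = b * b + 2 * b + 1 := by ring
  have heven : Even (b * b + b) := by
    rw [show b * b + b = b * (b + 1) from by ring]; exact Nat.even_mul_succ_self b
  -- two witnesses of Durfee sizes `d₀` and `d₀ - 2`, then the parity argument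
  suffices key : ∃ d₀, 3 ≤ d₀ ∧ d₀ * d₀ ≤ a ∧
      ((Even ((a - d₀) / 2) → SmPos L (Nat.Partition.column a)) ∧
        (Odd ((a - d₀) / 2) → AmPos L (Nat.Partition.column a))) ∧
      ((Even ((a - (d₀ - 2)) / 2) → SmPos L (Nat.Partition.column a)) ∧
        (Odd ((a - (d₀ - 2)) / 2) → AmPos L (Nat.Partition.column a))) by
    obtain ⟨d₀, hd3, hda, h₀, h₁⟩ := key
    have hd₀a : d₀ ≤ a := (Nat.le_mul_self d₀).trans hda
    have hshift : (a - (d₀ - 2)) / 2 = (a - d₀) / 2 + 1 := by omega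
    rw [hshift] at h₁
    rcases Nat.even_or_odd ((a - d₀) / 2) with hev | hod
    · exact ⟨h₀.1 hev, h₁.2 hev.add_one⟩
    · exact ⟨h₁.1 hod.add_one, h₀.2 hod⟩
  rcases Nat.even_or_odd (a + b) with hab | hab
  · -- `a ≡ b (mod 2)`: `d₀ = b`, `d₁ = b - 2`
    obtain ⟨h₀, hh₀⟩ : ∃ h₀, a = b * b + 2 * h₀ := by
      obtain ⟨k, hk⟩ := hab
      obtain ⟨m, hm⟩ := heven
      exact ⟨k - m, by omega⟩
    obtain ⟨b', rfl⟩ : ∃ b', b = b' + 2 := ⟨b - 2, by omega⟩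
    have hsq' : (b' + 2) * (b' + 2) = b' * b' + 4 * b' + 4 := by ring
    refine ⟨b' + 2, by omega, hb1, ?_, ?_⟩
    · refine smPos_amPos_column_of_le (h := h₀) (by omega) (by omega) hh₀ ?_
      calc h₀ ≤ b' + 2 := by omega
        _ ≤ (b' + 2) * 2 := by omega
        _ ≤ (b' + 2) * (L - (b' + 2)) := Nat.mul_le_mul_left _ (by omega)
    · rw [show b' + 2 - 2 = b' from rfl]
      refine smPos_amPos_column_of_le (h := h₀ + 2 * b' + 2) (by omega) (by omega) (by omega) ?_
      have hc := prop17_cap₂ (b := b' + 2) (by omega)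
      rw [← hL, show b' + 2 - 2 = b' from rfl] at hc
      calc h₀ + 2 * b' + 2 ≤ 3 * (b' + 2) - 2 := by omega
        _ ≤ b' * (L - (b' + 2) + 2) := hc
        _ = b' * (L - b') := by congr 1; omega
  · -- `a ≢ b (mod 2)`: `d₀ = b - 1`, `d₁ = b - 3`
    obtain ⟨b', rfl⟩ : ∃ b', b = b' + 3 := ⟨b - 3, by omega⟩
    have hsq₁ : (b' + 2) * (b' + 2) = b' * b' + 4 * b' + 4 := by ring
    have hsq₃ : (b' + 3) * (b' + 3) = b' * b' + 6 * b' + 9 := by ring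
    obtain ⟨h₀, hh₀⟩ : ∃ h₀, a = (b' + 2) * (b' + 2) + 2 * h₀ := by
      obtain ⟨k, hk⟩ := hab
      obtain ⟨m, hm⟩ := heven
      exact ⟨k + b' + 3 - m, by omega⟩
    refine ⟨b' + 2, by omega, by omega, ?_, ?_⟩
    · refine smPos_amPos_column_of_le (h := h₀) (by omega) (by omega) hh₀ ?_
      have hc := prop17_cap₁' (b := b' + 3) (by omega)
      rw [← hL, show b' + 3 - 1 = b' + 2 from rfl] at hc
      calc h₀ ≤ 2 * (b' + 3) - 1 := by omega
        _ ≤ (b' + 2) * (L - (b' + 3) + 1) := hc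
        _ = (b' + 2) * (L - (b' + 2)) := by congr 1; omega
    · rw [show b' + 2 - 2 = b' from rfl]
      refine smPos_amPos_column_of_le (h := h₀ + 2 * b' + 2) (by omega) (by omega) (by omega) ?_
      have hc := prop17_cap₂' (b := b' + 3) (by omega)
      rw [← hL, show b' + 3 - 3 = b' from rfl] at hc
      calc h₀ + 2 * b' + 2 ≤ 4 * (b' + 3) - 5 := by omega
        _ ≤ b' * (L - (b' + 3) + 3) := hc
        _ = b' * (L - b') := by congr 1; omega

/-- **GIP Prop. 17, "if" directions**: for `a ≥ 1`, `ℓ = max{⌊√a⌋ + 2, 12}`: `sm(1^a, ℓ) > 0` if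
`a ∉ X_s = {2,3,4,7,8,12}` and `am(1^a, ℓ) > 0` if `a ∉ X_a = {1,2,5,6,10,14}` — Thm. 16 applied to
explicit self-conjugate partitions of `a` with at most `ℓ` rows and prescribed sign (the printed
table for `a ≤ 14`, two-witness families beyond). [cite: GesmundoIkenmeyerPanova2017, Prop. 17] -/
theorem GIP2017_prop17_if (a : ℕ) (ha : 1 ≤ a) :
    (a ∉ gipXs → SmPos (max (Nat.sqrt a + 2) 12) (Nat.Partition.column a)) ∧
      (a ∉ gipXa → AmPos (max (Nat.sqrt a + 2) 12) (Nat.Partition.column a)) := by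
  rcases Nat.lt_or_ge a 16 with h16 | h16
  · have hL : max (Nat.sqrt a + 2) 12 = 12 := by
      refine max_eq_right ?_
      have : Nat.sqrt a < 4 := Nat.sqrt_lt'.mpr (by omega)
      omega
    rw [hL]
    -- the single witness of Durfee size `d ∈ {1, 2, 3}`; parity decides which of `sm`, `am` it serves
    have W : ∀ d h : ℕ, 1 ≤ d → d ≤ 12 → a = d * d + 2 * h → h ≤ d * (12 - d) →
        (Even ((a - d) / 2) → SmPos 12 (Nat.Partition.column a)) ∧
          (Odd ((a - d) / 2) → AmPos 12 (Nat.Partition.column a)) :=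
      fun d h hd hdL hD hcap => smPos_amPos_column_of_le hd hdL hD hcap
    interval_cases a
    · exact ⟨fun _ => (W 1 0 (by norm_num) (by norm_num) (by norm_num) (by norm_num)).1
        (by decide), fun h => (h (by decide)).elim⟩
    · exact ⟨fun h => (h (by decide)).elim, fun h => (h (by decide)).elim⟩
    · exact ⟨fun h => (h (by decide)).elim, fun _ => (W 1 1 (by norm_num) (by norm_num)
        (by norm_num) (by norm_num)).2 (by decide)⟩
    · exact ⟨fun h => (h (by decide)).elim, fun _ => (W 2 0 (by norm_num) (by norm_num)
        (by norm_num) (by norm_num)).2 (by decide)⟩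
    · exact ⟨fun _ => (W 1 2 (by norm_num) (by norm_num) (by norm_num) (by norm_num)).1
        (by decide), fun h => (h (by decide)).elim⟩
    · exact ⟨fun _ => (W 2 1 (by norm_num) (by norm_num) (by norm_num) (by norm_num)).1
        (by decide), fun h => (h (by decide)).elim⟩
    · exact ⟨fun h => (h (by decide)).elim, fun _ => (W 1 3 (by norm_num) (by norm_num)
        (by norm_num) (by norm_num)).2 (by decide)⟩
    · exact ⟨fun h => (h (by decide)).elim, fun _ => (W 2 2 (by norm_num) (by norm_num)
        (by norm_num) (by norm_num)).2 (by decide)⟩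
    · -- `a = 9`: `(3,3,3)` (d = 3, h = 0: (9-3)/2 = 3 odd ⇒ am) and `(5,1⁴)` (d = 1, h = 4: even ⇒ sm)
      exact ⟨fun _ => (W 1 4 (by norm_num) (by norm_num) (by norm_num) (by norm_num)).1
        (by decide), fun _ => (W 3 0 (by norm_num) (by norm_num) (by norm_num) (by norm_num)).2
          (by decide)⟩
    · exact ⟨fun _ => (W 2 3 (by norm_num) (by norm_num) (by norm_num) (by norm_num)).1
        (by decide), fun h => (h (by decide)).elim⟩
    · -- `a = 11`: d = 3, h = 1 ((11-3)/2 = 4 even ⇒ sm); d = 1, h = 5 (odd ⇒ am)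
      exact ⟨fun _ => (W 3 1 (by norm_num) (by norm_num) (by norm_num) (by norm_num)).1
        (by decide), fun _ => (W 1 5 (by norm_num) (by norm_num) (by norm_num) (by norm_num)).2
          (by decide)⟩
    · exact ⟨fun h => (h (by decide)).elim, fun _ => (W 2 4 (by norm_num) (by norm_num)
        (by norm_num) (by norm_num)).2 (by decide)⟩
    · -- `a = 13`: d = 3, h = 2 (odd ⇒ am); d = 1, h = 6 (even ⇒ sm)
      exact ⟨fun _ => (W 1 6 (by norm_num) (by norm_num) (by norm_num) (by norm_num)).1
        (by decide), fun _ => (W 3 2 (by norm_num) (by norm_num) (by norm_num) (by norm_num)).2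
          (by decide)⟩
    · exact ⟨fun _ => (W 2 5 (by norm_num) (by norm_num) (by norm_num) (by norm_num)).1
        (by decide), fun h => (h (by decide)).elim⟩
    · -- `a = 15`: d = 3, h = 3 (even ⇒ sm); d = 1, h = 7 (odd ⇒ am)
      exact ⟨fun _ => (W 3 3 (by norm_num) (by norm_num) (by norm_num) (by norm_num)).1
        (by decide), fun _ => (W 1 7 (by norm_num) (by norm_num) (by norm_num) (by norm_num)).2
          (by decide)⟩
  · have h := smPos_and_amPos_column_of_sixteen_le h16
    exact ⟨fun _ => h.1, fun _ => h.2⟩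

end Prop17If

/-! ### 2. Assembly: Prop. 20 (corrected), Thm. 10 and `GCTMatrixPowering` from Prop. 18 (corrected) alone -/

section Assembly

/-- Prop. 19's corrected bound `max{7, ⌈√k⌉ + 1}` for `(2,2,1^{k-2})`, `k ≤ L`, is at most
`ℓ = max{⌈√L⌉ + 2, 12}`. [cite: GesmundoIkenmeyerPanova2017, §3 (proof of Prop. 20)] -/
theorem max_seven_sqrt_add_two_le_gipEll {k L : ℕ} (hk : 2 ≤ k) (h : k ≤ L) :
    max 7 (Nat.sqrt (k - 2 + 1) + 2) ≤ gipEll L := by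
  have h1 : Nat.sqrt (k - 2 + 1) ≤ Nat.sqrt L := Nat.sqrt_le_sqrt (by omega)
  have h2 : Nat.sqrt L ≤ gipEll L - 2 := by
    have := Nat.sqrt_le_sqrt (le_gipEll_sub_two_sq L)
    rwa [Nat.sqrt_eq'] at this
  have h3 := twelve_le_gipEll L
  omega

/-- A nonexceptional column `1^c`, `c ∉ X_s`, `1 ≤ c ≤ L`, has `sm(1^c, ℓ) > 0` — from the PROVED
"if" direction of Prop. 17. [cite: GesmundoIkenmeyerPanova2017, §3 (proof of Prop. 20)] -/
theorem smPos_column_holds {c L : ℕ} (hc1 : 1 ≤ c) (hcL : c ≤ L) (hcs : c ∉ gipXs) :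
    SmPos (gipEll L) (Nat.Partition.column c) :=
  ((GIP2017_prop17_if c hc1).1 hcs).mono (max_sqrt_add_two_le_gipEll hcL)

/-- A column `1^c`, `c ∉ X_a`, `1 ≤ c ≤ L`, has `am(1^c, ℓ) > 0` — from the proved "if" direction
of Prop. 17. [cite: GesmundoIkenmeyerPanova2017, §3 (proof of Prop. 20)] -/
theorem amPos_column_holds {c L : ℕ} (hc1 : 1 ≤ c) (hcL : c ≤ L) (hca : c ∉ gipXa) :
    AmPos (gipEll L) (Nat.Partition.column c) :=
  ((GIP2017_prop17_if c hc1).2 hca).mono (max_sqrt_add_two_le_gipEll hcL)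

/-- Adding up nonexceptional columns (Prop. 15(1), proved: `GIP2017_prop15_holds`).
[cite: GesmundoIkenmeyerPanova2017, §3 (proof of Prop. 20)] -/
theorem smPos_ofColumns_holds {L : ℕ} :
    ∀ S : Multiset ℕ, (∀ c ∈ S, 1 ≤ c ∧ c ≤ L ∧ c ∉ gipXs) → SmPos (gipEll L) (ofColumns S) := by
  intro S
  induction S using Multiset.induction_on with
  | empty =>
    intro _
    exact smPos_of_eq_zero (by simp) _ _
  | cons c S ih =>
    intro hS
    obtain ⟨hc1, hcL, hcs⟩ := hS c (Multiset.mem_cons_self c S)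
    have hrs : IsRowSum (ofColumns (c ::ₘ S)) (Nat.Partition.column c) (ofColumns S) :=
      isRowSum_of_colCount (fun r => by rw [getD_sortedParts_ofColumns, Multiset.singleton_add])
        (getD_sortedParts_column c) (getD_sortedParts_ofColumns S)
    exact (GIP2017_prop15_holds (gipEll L) (gipEll_pos L) _ _ _ hrs).1
      (smPos_column_holds hc1 hcL hcs) (ih fun c' hc' => hS c' (Multiset.mem_cons_of_mem hc'))

/-- **GIP Prop. 20 (corrected) from Prop. 18 (corrected) alone**: the printed case analysis of
`GIP2017_prop20_corrected_of_parts` (Erratum file) with its other three ingredients now PROVED —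
Prop. 15 (`GIP2017_prop15_holds`), the "if" directions of Prop. 17 (`GIP2017_prop17_if`, all the
printed proof uses), and the corrected Prop. 19 (`GIP2017_prop19_corrected_holds`, applied to
`(2,2,1^{k-2})`, `k > 14`, where `ℓ ≥ ⌈√k⌉ + 2` absorbs the corrected bound).
[cite: GesmundoIkenmeyerPanova2017, Prop. 20 (proof, §3)] -/
theorem GIP2017_prop20_corrected_of_prop18 (h18 : GIP2017_prop18_corrected) :
    GIP2017_prop20_corrected := by
  intro D L lam hL hE h22
  -- the columns `C` of `λ`, the exceptional ones `X` and the others `A`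
  set C := lam.transpose.parts with hC
  have hCpos : ∀ c ∈ C, 1 ≤ c := fun c hc => transpose_parts_pos lam c hc
  have hCL : ∀ c ∈ C, c ≤ L := fun c hc => (le_card_parts_of_mem_transpose lam hc).trans hL
  have hlamC : ∀ r, lam.sortedParts.getD r 0 = colCount C r :=
    getD_sortedParts_eq_colCount_transpose lam
  have hcardlam : lam.parts.card = C.sup := card_parts_eq_sup_transpose lam
  set X := C.filter (fun c => c ∈ gipXs) with hX
  set A := C.filter (fun c => c ∉ gipXs) with hA
  have hCXA : C = X + A := (Multiset.filter_add_not _ C).symm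
  have hAgood : ∀ c ∈ A, 1 ≤ c ∧ c ≤ L ∧ c ∉ gipXs := fun c hc => by
    rw [hA, Multiset.mem_filter] at hc
    exact ⟨hCpos c hc.1, hCL c hc.1, hc.2⟩
  have hXs : ∀ c ∈ X, c ∈ gipXs := fun c hc => by
    rw [hX, Multiset.mem_filter] at hc
    exact hc.2
  have hXge : ∀ c ∈ X, 2 ≤ c ∧ c ≤ 12 := fun c hc => by
    have h := hXs c hc
    simp only [gipXs, Finset.mem_insert, Finset.mem_singleton] at h
    omega
  -- the tools
  have h12 : 12 ≤ gipEll L := twelve_le_gipEll L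
  have combine : ∀ {c a b : ℕ} {lam' : Nat.Partition c} {mu : Nat.Partition a}
      {nu : Nat.Partition b},
      IsRowSum lam' mu nu → SmPos (gipEll L) mu → SmPos (gipEll L) nu → SmPos (gipEll L) lam' :=
    fun hrs hmu hnu => (GIP2017_prop15_holds (gipEll L) (gipEll_pos L) _ _ _ hrs).1 hmu hnu
  have good : ∀ S : Multiset ℕ, S ≤ A → SmPos (gipEll L) (ofColumns S) := fun S hS =>
    smPos_ofColumns_holds S fun c hc => hAgood c (Multiset.mem_of_le hS hc)
  have small : ∀ {c : ℕ} (nu : Nat.Partition c), nu.parts.card ≤ 14 →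
      nu.parts ∉ gipExceptionalShapesCorrected → SmPos (gipEll L) nu :=
    fun nu h1 h2 => (h18 _ nu h1 h2).mono (by omega)
  -- case analysis on the number of exceptional columns
  rcases Nat.lt_or_ge X.card 2 with hx | hx
  · rcases Nat.lt_or_ge X.card 1 with hx0 | hx1
    · -- `x = 0`: all columns are good
      have hX0 : X = 0 := Multiset.card_eq_zero.mp (by omega)
      have hrs : IsRowSum lam (ofColumns X) (ofColumns A) := isRowSum_ofColumns lam hCXA
      refine combine hrs ?_ (good A le_rfl)
      exact smPos_of_eq_zero (by rw [hX0, Multiset.sum_zero]) _ _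
    · -- `x = 1`: one exceptional column of length `r`
      obtain ⟨r, hXr⟩ := Multiset.card_eq_one.mp (by omega : X.card = 1)
      have hr : r ∈ gipXs := hXs r (by rw [hXr]; exact Multiset.mem_singleton_self r)
      have hr2 : 2 ≤ r ∧ r ≤ 12 := hXge r (by rw [hXr]; exact Multiset.mem_singleton_self r)
      -- there is another column; let `k` be the longest one
      have hA0 : A ≠ 0 := by
        intro hA0
        apply hE
        have hCr : C = {r} := by rw [hCXA, hXr, hA0, add_zero]
        have hparts : lam.parts = (Nat.Partition.column r).parts :=
          Literature.Computability.Complexity.parts_eq_of_getD_sortedParts_eq fun i => by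
            rw [hlamC, hCr, getD_sortedParts_column]
        rw [hparts, Nat.Partition.column_parts]
        exact (replicate_mem_gipExceptionalShapesCorrected_iff r).mpr hr
      set k := A.sup with hk
      have hkA : k ∈ A := sup_mem_of_ne_zero hA0
      obtain ⟨hk1, hkL, hks⟩ := hAgood k hkA
      have hAle : ∀ c ∈ A, c ≤ k := fun c hc => Multiset.le_sup hc
      set A' := A.erase k with hA'
      have hAk : A = k ::ₘ A' := (Multiset.cons_erase hkA).symm
      have hA'le : A' ≤ A := Multiset.erase_le k A
      have hCk : C = ({k} + {r}) + A' := by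
        rw [hCXA, hXr, hAk, ← Multiset.singleton_add]
        abel
      -- the hook case: all other columns are singletons, `λ` itself is small
      have hook : k = 1 → SmPos (gipEll L) lam := by
        intro hk1'
        refine small lam ?_ hE
        rw [hcardlam, Multiset.sup_le]
        intro c hc
        rw [hCXA, Multiset.mem_add] at hc
        rcases hc with hc | hc
        · exact (hXge c hc).2.trans (by norm_num)
        · exact (hAle c hc).trans (by omega)
      by_cases hr_two : r = 2
      · -- the exceptional column has length `2`
        subst hr_two
        rcases Nat.lt_or_ge k 2 with hk_lt | hk_ge
        · exact hook (by omega)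
        by_cases hA'0 : A' = 0
        · -- `λ = (2,2,1^{k-2})` is excluded
          exfalso
          apply h22 (k - 2)
          have hCk2 : C = {k - 2 + 2, 2} := by
            rw [hCk, hA'0, add_zero, Multiset.insert_eq_cons, ← Multiset.singleton_add,
              Nat.sub_add_cancel hk_ge]
          have hparts : lam.parts = (twoTwoCol (k - 2)).parts :=
            Literature.Computability.Complexity.parts_eq_of_getD_sortedParts_eq fun i => by
              rw [hlamC, hCk2, getD_sortedParts_twoTwoCol]
          rw [hparts, twoTwoCol_parts]
        rcases Nat.lt_or_ge 14 k with hk14 | hk14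
        · -- `k > 14`: corrected Prop. 19 on `(2,2,1^{k-2})`, whose rows are those of the columns `k, 2`
          have hrows : ∀ i, (twoTwoCol (k - 2)).sortedParts.getD i 0 = colCount ({k} + {2}) i := by
            intro i
            rw [getD_sortedParts_twoTwoCol, Nat.sub_add_cancel hk_ge, Multiset.insert_eq_cons,
              ← Multiset.singleton_add]
          have hbound : max 7 (Nat.sqrt (k - 2 + 1) + 2) ≤ gipEll L :=
            max_seven_sqrt_add_two_le_gipEll hk_ge hkL
          rcases GIP2017_prop19_corrected_holds (k - 2) with hsm | ham
          · -- `sm((2,2,1^{k-2}), ℓ) > 0`: add the remaining columns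
            have hrs : IsRowSum lam (twoTwoCol (k - 2)) (ofColumns A') :=
              isRowSum_of_colCount (fun i => by rw [hlamC, hCk]) hrows
                (getD_sortedParts_ofColumns A')
            exact combine hrs (hsm.mono hbound) (good A' hA'le)
          · -- `am((2,2,1^{k-2}), ℓ) > 0`: a second long column `k₂` with `am(1^{k₂}, ℓ) > 0`
            set k₂ := A'.sup with hk₂
            have hk₂A' : k₂ ∈ A' := sup_mem_of_ne_zero hA'0
            obtain ⟨hk₂1, hk₂L, hk₂s⟩ := hAgood k₂ (Multiset.mem_of_le hA'le hk₂A')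
            set A'' := A'.erase k₂ with hA''
            have hA'k : A' = k₂ ::ₘ A'' := (Multiset.cons_erase hk₂A').symm
            have hA''le : A'' ≤ A := (Multiset.erase_le k₂ A').trans hA'le
            rcases Nat.lt_or_ge 14 k₂ with hk₂14 | hk₂14
            · have hk₂a : k₂ ∉ gipXa := by
                simp only [gipXa, Finset.mem_insert, Finset.mem_singleton]
                omega
              -- `δ` = columns `k, 2, k₂`
              have hδ : IsRowSum (ofColumns (({k} + {2}) + {k₂})) (twoTwoCol (k - 2))
                  (Nat.Partition.column k₂) :=
                isRowSum_of_colCount (getD_sortedParts_ofColumns _) hrows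
                  (getD_sortedParts_column k₂)
              have hδpos : SmPos (gipEll L) (ofColumns (({k} + {2}) + {k₂})) :=
                (GIP2017_prop15_holds (gipEll L) (gipEll_pos L) _ _ _ hδ).2.1 (ham.mono hbound)
                  (amPos_column_holds hk₂1 hk₂L hk₂a)
              have hCk' : C = (({k} + {2}) + {k₂}) + A'' := by
                rw [hCk, hA'k, ← Multiset.singleton_add]
                abel
              have hrs : IsRowSum lam (ofColumns (({k} + {2}) + {k₂})) (ofColumns A'') :=
                isRowSum_of_colCount (fun i => by rw [hlamC, hCk']) (getD_sortedParts_ofColumns _)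
                  (getD_sortedParts_ofColumns A'')
              exact combine hrs hδpos (good A'' hA''le)
            · -- `k₂ ≤ 14`: Prop. 18 on the columns `k₂, 2`
              have hγsmall : SmPos (gipEll L) (ofColumns ({k₂} + {2})) := by
                refine small _ ?_ ?_
                · rw [card_parts_ofColumns, Multiset.sup_add, Multiset.sup_singleton,
                    Multiset.sup_singleton]
                  exact sup_le hk₂14 (by norm_num)
                · rcases Nat.lt_or_ge k₂ 2 with hk₂lt | hk₂ge
                  · -- the shape `(2,1)`: two parts, largest part `2`
                    intro hmem
                    have hk₂one : k₂ = 1 := by omega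
                    have hcard : (ofColumns ({k₂} + {2})).parts.card = 2 := by
                      rw [card_parts_ofColumns, Multiset.sup_add, Multiset.sup_singleton,
                        Multiset.sup_singleton, hk₂one]
                      decide
                    have hsup : (ofColumns ({k₂} + {2})).parts.sup = 2 := by
                      rw [sup_parts_ofColumns]
                      · simp
                      · intro c hc
                        simp only [Multiset.mem_add, Multiset.mem_singleton] at hc
                        omega
                    have :=
                      sup_eq_one_of_mem_gipExceptionalShapesCorrected_of_card_eq_two hmem hcard
                    omega
                  · exact parts_ofColumns_not_mem_corrected (fun c hc => by
                      simp only [Multiset.mem_add, Multiset.mem_singleton] at hc; omega) (by simp)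
              have hCk' : C = ({k₂} + {2}) + ({k} + A'') := by
                rw [hCk, hA'k, ← Multiset.singleton_add]
                abel
              have hrs : IsRowSum lam (ofColumns ({k₂} + {2})) (ofColumns ({k} + A'')) :=
                isRowSum_of_colCount (fun i => by rw [hlamC, hCk']) (getD_sortedParts_ofColumns _)
                  (getD_sortedParts_ofColumns _)
              refine combine hrs hγsmall (good _ ?_)
              rw [Multiset.singleton_add, hAk]
              exact Multiset.cons_le_cons k (Multiset.erase_le k₂ A')
        · -- `2 ≤ k ≤ 14`: Prop. 18 on the columns `k, 2` (a shape with two columns `≥ 2`)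
          have hγsmall : SmPos (gipEll L) (ofColumns ({k} + {2})) := by
            refine small _ ?_ (parts_ofColumns_not_mem_corrected (fun c hc => by
              simp only [Multiset.mem_add, Multiset.mem_singleton] at hc; omega) (by simp))
            rw [card_parts_ofColumns, Multiset.sup_add, Multiset.sup_singleton,
              Multiset.sup_singleton]
            exact sup_le hk14 (by norm_num)
          have hrs : IsRowSum lam (ofColumns ({k} + {2})) (ofColumns A') :=
            isRowSum_of_colCount (fun i => by rw [hlamC, hCk]) (getD_sortedParts_ofColumns _)
              (getD_sortedParts_ofColumns A')
          exact combine hrs hγsmall (good A' hA'le)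
      · -- the exceptional column has length `r ≠ 2`, so `r ∉ X_a`
        have hra : r ∉ gipXa := by
          simp only [gipXs, Finset.mem_insert, Finset.mem_singleton] at hr
          simp only [gipXa, Finset.mem_insert, Finset.mem_singleton]
          omega
        by_cases hka : k ∈ gipXa
        · rcases Nat.lt_or_ge k 2 with hk_lt | hk_ge
          · exact hook (by omega)
          · -- `k ∈ X_a`, `k ≥ 2`: Prop. 18 on the columns `k, r` (both `≥ 2`, `k ≤ 14`)
            have hk14 : k ≤ 14 := by
              simp only [gipXa, Finset.mem_insert, Finset.mem_singleton] at hka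
              omega
            have hγsmall : SmPos (gipEll L) (ofColumns ({k} + {r})) := by
              refine small _ ?_ (parts_ofColumns_not_mem_corrected (fun c hc => by
                simp only [Multiset.mem_add, Multiset.mem_singleton] at hc; omega) (by simp))
              rw [card_parts_ofColumns, Multiset.sup_add, Multiset.sup_singleton,
                Multiset.sup_singleton]
              exact sup_le hk14 (by omega)
            have hrs : IsRowSum lam (ofColumns ({k} + {r})) (ofColumns A') :=
              isRowSum_of_colCount (fun i => by rw [hlamC, hCk]) (getD_sortedParts_ofColumns _)
                (getD_sortedParts_ofColumns A')
            exact combine hrs hγsmall (good A' hA'le)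
        · -- `k ∉ X_a`: `am(1^k, ℓ), am(1^r, ℓ) > 0`, so `sm(1^k + 1^r, ℓ) > 0` by Prop. 15(2)
          have hγ : IsRowSum (ofColumns ({k} + {r})) (Nat.Partition.column k)
              (Nat.Partition.column r) :=
            isRowSum_of_colCount (getD_sortedParts_ofColumns _) (getD_sortedParts_column k)
              (getD_sortedParts_column r)
          have hrC : r ∈ C := by
            rw [hCXA, hXr]
            exact Multiset.mem_add.mpr (Or.inl (Multiset.mem_singleton_self r))
          have hγpos : SmPos (gipEll L) (ofColumns ({k} + {r})) :=
            (GIP2017_prop15_holds (gipEll L) (gipEll_pos L) _ _ _ hγ).2.1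
              (amPos_column_holds hk1 hkL hka) (amPos_column_holds (by omega) (hCL r hrC) hra)
          have hrs : IsRowSum lam (ofColumns ({k} + {r})) (ofColumns A') :=
            isRowSum_of_colCount (fun i => by rw [hlamC, hCk]) (getD_sortedParts_ofColumns _)
              (getD_sortedParts_ofColumns A')
          exact combine hrs hγpos (good A' hA'le)
  · -- `x ≥ 2`: Prop. 18 on the exceptional columns, Prop. 17 + 15(1) on the others
    have hβsmall : SmPos (gipEll L) (ofColumns X) := by
      refine small _ ?_ (parts_ofColumns_not_mem_corrected (fun c hc => (hXge c hc).1) hx)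
      rw [card_parts_ofColumns, Multiset.sup_le]
      exact fun c hc => (hXge c hc).2.trans (by norm_num)
    exact combine (isRowSum_ofColumns lam hCXA) hβsmall (good A le_rfl)

/-- **GIP Thm. 10 from Prop. 18 (corrected) alone.** [cite: GesmundoIkenmeyerPanova2017, Thm. 10 (proof, pp. 7 and 12)] -/
theorem GIP2017_thm10_of_prop18 (h18 : GIP2017_prop18_corrected) : GIP2017_thm10 :=
  GIP2017_thm10_of_prop20_corrected (GIP2017_prop20_corrected_of_prop18 h18)

/-- **The barrier fact `GCTMatrixPowering` (= GIP Thm. 10) from the single remaining named fact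
`GIP2017_prop18_corrected`** — the published computer calculation (Derksen–Hüttenhain program) of
`sm(λ, 7) > 0` for the shapes with at most `14` rows off the ten-shape list; everything else in
GIP's proof of Thm. 10 (Lemma 12, Prop. 13, Prop. 15, Thm. 16, Prop. 17's positivity, the corrected
Prop. 19, the assembly of Prop. 20 and Prop. 14) is PROVED in the tree.
[cite: GesmundoIkenmeyerPanova2017, Thm. 10] -/
theorem gctMatrixPowering_of_prop18 (h18 : GIP2017_prop18_corrected) : GCTMatrixPowering :=
  GIP2017_thm10_of_prop18 h18

end Assembly

end Literature.Barriers.ValiantsHypothesis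

end
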